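import Literature.NumberTheory.Automorphic.TorusIntegrandThinSupport
import Literature.NumberTheory.Automorphic.WhittakerBiEquivariantSupportLevel
import Summits.Langlands.Langlands.Theorems.IrreducibilityBySelfDualityPairLBoundaryJSWhittakerSupportValueLastRow

/-!
# Crux `PairLBoundaryJS` (stmt-Langlands-13622), line `Sketch` — stub `stub_unitBox_translate_productForm` (W4a),
# part 2: the local value theorem for a pair at a thin place

Summit `Langlands`, sub-problem `Langlands`, helper file under `Theorems/` supporting the crux
`PairLBoundaryJS` (Arthur–Clozel (1989), Ch. 3, (2.2)), line `Sketch`, registered stub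
`stub_unitBox_translate_productForm` (proved in `…PairLBoundaryJSUnitBoxTranslateProductForm`, which imports this
file); this file proves the registered sub-goal `stub_unitBox_translate_localValue`.

The finite-place content of the bad-place step of the Rankin–Selberg method for a PAIR
(Jacquet–Piatetski-Shapiro–Shalika (1983), (2.7): the local integral of suitable data is a non-zero constant).
For `W` left `ψ`-equivariant on `GL_{n+1}(𝔸_K)` and spread at `v` (`IsSpreadWhittakerAt v ψ t M W`, `ψ_v` non-trivial
on `{|x| ≤ exp(1 - c₀)}`, `M ≥ 1`, monotone `|t_i|` with gaps, `exp(-m)|t_0| ≤ exp(-M)|t_n|`), put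
`K♯_v = {k ∈ K_v(𝔭^M) : W(g ι_v(k)) = W(g) for all g}` (a subgroup containing `K_v(𝔭^m)`,
`sharp_of_mem_valuedCongruenceSubgroup`, so that `N_v K♯_v` is right `K_v(𝔭^m)`-stable, `exists_sharp_mul_iff`).

* `exists_sharp_of_ne_zero` — for a base point `g'` with trivial `v`-component and `x ∈ GL_{n+1}(K_v)` with last row
  `≡ e_{n+1} (mod 𝔭_v^m)`: `W(g' ι_v(x)) ≠ 0 ⟹ x ∈ N_v K♯_v`. The tree's level-form support theorem
  `WhittakerSupport.exists_eq_unipotent_mul_level_of_lastRow` gives `x = u k` with `k ∈ K_v(𝔭^M)` invisible to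
  `y ↦ W(g' ι_v(y))`; lead c2's `WhittakerSupportValue.apply_eq_whittakerCharFun_mul_apply_one_of_lastRow_sub_le`
  gives `x = u' k'` with `k'` integral in the spread level set; then `n₀ = u⁻¹u' = k k'⁻¹ ∈ N_v ∩ GL_{n+1}(𝒪_v)` acts
  on `W` by the phase `ψ_v(n₀)` (`IsSpreadWhittakerAt.right`), which the non-vanishing at `g'` forces to be `1`; so
  `k = n₀ k'` is invisible to `W` at EVERY base point (`sharp_of_two_decompositions`).
* `pair_apply_mul_ofLocal_eq` (= `stub_unitBox_translate_localValue`) — with moreover `W'` left `ψ`-equivariant and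
  right `K_v(𝔭^M)`-invariant: `W(g' ι_v(x)) W̄'(g' ι_v(x)) = 𝟙[x ∈ N_v K♯_v] · W(g') W̄'(g')` (on `N_v K♯_v` both take
  the value `ψ_v(u) ×` (value at `g'`), `GLn.ofLocal_mul_eq_mul_ofLocal_of_toLocal_eq_one`, and the phases cancel).

All proofs complete; tree theorems only.

## References

* H. Jacquet, I. I. Piatetski-Shapiro, J. A. Shalika, *Rankin–Selberg convolutions*, Amer. J. Math.
  105 (1983), §2, (2.7) [JacquetPiatetskiShapiroShalika1983].
* J. W. Cogdell, *Analytic theory of L-functions for GL_n*, in *An Introduction to the Langlands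
  Program* (2004), §4.1 [CogdellAnalyticTheory2004].
-/

noncomputable section

-- `Summit.Langlands.Langlands.…` (summit = sub-problem name, D-0017 layout) trips `dupNamespace`
set_option linter.dupNamespace false

open scoped MatrixGroups Topology Pointwise ENNReal NNReal ComplexConjugate InnerProductSpace ContDiff
-- the place subtypes indexing `mixedSpace K` are `Fintype` classically (`NormedCommRing (mixedSpace K)`)
open scoped Classical Matrix.Norms.Operator
open NumberField IsDedekindDomain MeasureTheory Measure Matrix Set Filter WithZero
open NumberField.mixedEmbedding
open Literature.NumberTheory.Automorphic AdelicGroupData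
open Literature.NumberTheory.GaloisRepresentations (ideleGroup HeckeCharacter)
open ValuativeRel

-- no local instances needed in this file

namespace Summit.Langlands.Langlands.Theorems.UnitBoxTranslateProductForm

/-! ### The local stabiliser `K♯_v = {k ∈ K_v(𝔭^M) : W(g ι_v(k)) = W(g) for all g}` and the value theorem -/

section Sharp

variable {n : ℕ} {K : Type} [Field K] [NumberField K] {v : HeightOneSpectrum (𝓞 K)}
  {ψ : AddChar (AdeleRing (𝓞 K) K) Circle} {W W' : GL (Fin (n + 1)) (AdeleRing (𝓞 K) K) → ℂ}
  {t : Fin (n + 1) → (v.adicCompletion K)ˣ} {M c₀ : ℤ} {m : ℕ}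

/-- From `|t_j| ≤ |t_i|` (`i ≤ j`) and `exp(-m)|t_0| ≤ exp(-M)|t_n|`: `exp(-m) ≤ exp(-M)`. [folklore] -/
theorem exp_neg_le_exp_neg
    (hmono : ∀ i j : Fin (n + 1), i ≤ j → Valued.v (t j : v.adicCompletion K) ≤ Valued.v (t i : v.adicCompletion K))
    (hmt : exp (-(m : ℤ)) * Valued.v (t 0 : v.adicCompletion K) ≤
      exp (-M) * Valued.v (t (Fin.last n) : v.adicCompletion K)) :
    exp (-(m : ℤ)) ≤ exp (-M) := by
  have ht0 : Valued.v (t 0 : v.adicCompletion K) ≠ 0 := (Valuation.ne_zero_iff _).2 (t 0).ne_zero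
  have h : exp (-(m : ℤ)) * Valued.v (t 0 : v.adicCompletion K) ≤ exp (-M) * Valued.v (t 0 : v.adicCompletion K) :=
    hmt.trans (mul_le_mul_right (hmono 0 (Fin.last n) (Fin.zero_le _)) _)
  exact le_of_mul_le_mul_right h (zero_lt_iff.mpr ht0)

/-- **A congruence element of depth `m` satisfies the spread level inequalities**:
`|(w - 1)_{ij} t_j| ≤ exp(-m)|t_0| ≤ exp(-M)|t_n| ≤ exp(-M)|t_i|` for `w ∈ K_v(𝔭^m)`. [folklore] -/
theorem level_of_mem_valuedCongruenceSubgroup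
    (hmono : ∀ i j : Fin (n + 1), i ≤ j → Valued.v (t j : v.adicCompletion K) ≤ Valued.v (t i : v.adicCompletion K))
    (hmt : exp (-(m : ℤ)) * Valued.v (t 0 : v.adicCompletion K) ≤
      exp (-M) * Valued.v (t (Fin.last n) : v.adicCompletion K))
    {w : GL (Fin (n + 1)) (v.adicCompletion K)} (hw : w ∈ valuedCongruenceSubgroup (Fin (n + 1)) (exp (-(m : ℤ))))
    (i j : Fin (n + 1)) :
    Valued.v (((w : Matrix (Fin (n + 1)) (Fin (n + 1)) (v.adicCompletion K)) - 1) i j * t j) ≤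
      exp (-M) * Valued.v (t i : v.adicCompletion K) :=
  calc Valued.v (((w : Matrix (Fin (n + 1)) (Fin (n + 1)) (v.adicCompletion K)) - 1) i j * t j)
      = Valued.v (((w : Matrix (Fin (n + 1)) (Fin (n + 1)) (v.adicCompletion K)) - 1) i j) *
          Valued.v (t j : v.adicCompletion K) := Valuation.map_mul _ _ _
    _ ≤ exp (-(m : ℤ)) * Valued.v (t 0 : v.adicCompletion K) := mul_le_mul' (hw.2.2 i j) (hmono 0 j (Fin.zero_le _))
    _ ≤ exp (-M) * Valued.v (t (Fin.last n) : v.adicCompletion K) := hmt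
    _ ≤ exp (-M) * Valued.v (t i : v.adicCompletion K) := mul_le_mul_right (hmono i (Fin.last n) (Fin.le_last i)) _

/-- **`K_v(𝔭^m) ⊆ K♯_v`**: a congruence element of depth `m` lies in `K_v(𝔭^M)` and is invisible to the
spread function `W` at every base point (`IsSpreadWhittakerAt.level`). [folklore] -/
theorem sharp_of_mem_valuedCongruenceSubgroup (hW : IsSpreadWhittakerAt v ψ t M W)
    (hmono : ∀ i j : Fin (n + 1), i ≤ j → Valued.v (t j : v.adicCompletion K) ≤ Valued.v (t i : v.adicCompletion K))
    (hmt : exp (-(m : ℤ)) * Valued.v (t 0 : v.adicCompletion K) ≤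
      exp (-M) * Valued.v (t (Fin.last n) : v.adicCompletion K))
    {w : GL (Fin (n + 1)) (v.adicCompletion K)} (hw : w ∈ valuedCongruenceSubgroup (Fin (n + 1)) (exp (-(m : ℤ)))) :
    w ∈ valuedCongruenceSubgroup (Fin (n + 1)) (exp (-M)) ∧
      ∀ g : GL (Fin (n + 1)) (AdeleRing (𝓞 K) K), W (g * GLn.ofLocal (n + 1) K v w) = W g :=
  ⟨valuedCongruenceSubgroup_mono (Fin (n + 1)) (exp_neg_le_exp_neg hmono hmt) hw, fun g =>
    hW.level w (level_of_mem_valuedCongruenceSubgroup hmono hmt hw)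
      (level_of_mem_valuedCongruenceSubgroup hmono hmt (inv_mem hw)) g⟩

/-- **`N_v · K♯_v` is right `K_v(𝔭^m)`-stable**: for `w ∈ K_v(𝔭^m)`, `x w ∈ N_v K♯_v ↔ x ∈ N_v K♯_v`. [folklore] -/
theorem exists_sharp_mul_iff (hW : IsSpreadWhittakerAt v ψ t M W)
    (hmono : ∀ i j : Fin (n + 1), i ≤ j → Valued.v (t j : v.adicCompletion K) ≤ Valued.v (t i : v.adicCompletion K))
    (hmt : exp (-(m : ℤ)) * Valued.v (t 0 : v.adicCompletion K) ≤
      exp (-M) * Valued.v (t (Fin.last n) : v.adicCompletion K))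
    (x : GL (Fin (n + 1)) (v.adicCompletion K))
    {w : GL (Fin (n + 1)) (v.adicCompletion K)} (hw : w ∈ valuedCongruenceSubgroup (Fin (n + 1)) (exp (-(m : ℤ)))) :
    (∃ u ∈ upperUnitriangular (Fin (n + 1)) (v.adicCompletion K), ∃ k : GL (Fin (n + 1)) (v.adicCompletion K),
        (k ∈ valuedCongruenceSubgroup (Fin (n + 1)) (exp (-M)) ∧
          ∀ g : GL (Fin (n + 1)) (AdeleRing (𝓞 K) K), W (g * GLn.ofLocal (n + 1) K v k) = W g) ∧ x * w = u * k) ↔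
      ∃ u ∈ upperUnitriangular (Fin (n + 1)) (v.adicCompletion K), ∃ k : GL (Fin (n + 1)) (v.adicCompletion K),
        (k ∈ valuedCongruenceSubgroup (Fin (n + 1)) (exp (-M)) ∧
          ∀ g : GL (Fin (n + 1)) (AdeleRing (𝓞 K) K), W (g * GLn.ofLocal (n + 1) K v k) = W g) ∧ x = u * k := by
  obtain ⟨hwK, hwW⟩ := sharp_of_mem_valuedCongruenceSubgroup hW hmono hmt hw
  constructor
  · rintro ⟨u, hu, k, ⟨hkK, hkW⟩, hxw⟩
    refine ⟨u, hu, k * w⁻¹, ⟨mul_mem hkK (inv_mem hwK), fun g => ?_⟩, ?_⟩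
    · calc W (g * GLn.ofLocal (n + 1) K v (k * w⁻¹))
          = W (g * GLn.ofLocal (n + 1) K v (k * w⁻¹) * GLn.ofLocal (n + 1) K v w) := (hwW _).symm
        _ = W (g * GLn.ofLocal (n + 1) K v k) := by rw [mul_assoc, ← map_mul, inv_mul_cancel_right]
        _ = W g := hkW g
    · rw [← mul_assoc, ← hxw, mul_inv_cancel_right]
  · rintro ⟨u, hu, k, ⟨hkK, hkW⟩, rfl⟩
    exact ⟨u, hu, k * w, ⟨mul_mem hkK hwK, fun g => by rw [map_mul, ← mul_assoc, hwW, hkW]⟩, by rw [mul_assoc]⟩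

/-- **Left equivariance at a base point with trivial `v`-component**: `W(g' ι_v(u)) = ψ_v(u) W(g')` for
`u ∈ N_{n+1}(K_v)` (`g'` commutes with `ι_v(u)`, `GLn.ofLocal_mul_eq_mul_ofLocal_of_toLocal_eq_one`). [folklore] -/
theorem apply_mul_ofLocal_unipotent
    (hWN : ∀ (u : ↥(adelicUnipotent (n + 1) K)) (g : GL (Fin (n + 1)) (AdeleRing (𝓞 K) K)),
      W ((u : GL (Fin (n + 1)) (AdeleRing (𝓞 K) K)) * g) = whittakerCharFun ψ u * W g)
    {g' : GL (Fin (n + 1)) (AdeleRing (𝓞 K) K)} (hg' : localComponent v g' = 1)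
    {u : GL (Fin (n + 1)) (v.adicCompletion K)} (hu : u ∈ upperUnitriangular (Fin (n + 1)) (v.adicCompletion K)) :
    W (g' * GLn.ofLocal (n + 1) K v u) = whittakerCharFun (ψ.adicComponent v) ⟨u, hu⟩ * W g' := by
  rw [← GLn.ofLocal_mul_eq_mul_ofLocal_of_toLocal_eq_one u hg', ← whittakerCharFun_ofLocal ψ ⟨u, hu⟩]
  exact hWN ⟨GLn.ofLocal (n + 1) K v u, ofLocal_mem_adelicUnipotent hu⟩ g'

/-- **The value on `N_v · K♯_v`**: `W(g' ι_v(u k)) = ψ_v(u) W(g')` when `k` is invisible to `W`. [folklore] -/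
theorem apply_mul_ofLocal_unipotent_mul_sharp
    (hWN : ∀ (u : ↥(adelicUnipotent (n + 1) K)) (g : GL (Fin (n + 1)) (AdeleRing (𝓞 K) K)),
      W ((u : GL (Fin (n + 1)) (AdeleRing (𝓞 K) K)) * g) = whittakerCharFun ψ u * W g)
    {g' : GL (Fin (n + 1)) (AdeleRing (𝓞 K) K)} (hg' : localComponent v g' = 1)
    {u : GL (Fin (n + 1)) (v.adicCompletion K)} (hu : u ∈ upperUnitriangular (Fin (n + 1)) (v.adicCompletion K))
    {k : GL (Fin (n + 1)) (v.adicCompletion K)}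
    (hk : ∀ g : GL (Fin (n + 1)) (AdeleRing (𝓞 K) K), W (g * GLn.ofLocal (n + 1) K v k) = W g) :
    W (g' * GLn.ofLocal (n + 1) K v (u * k)) = whittakerCharFun (ψ.adicComponent v) ⟨u, hu⟩ * W g' := by
  rw [map_mul, ← mul_assoc, hk, apply_mul_ofLocal_unipotent hWN hg' hu]

/-- **Combining the two support theorems.** If `x = u k = u' k'` with `u, u' ∈ N_v`, `k ∈ K_v(𝔭^M)`
invisible to `y ↦ W(g' ι_v(y))`, `k' ∈ GL_{n+1}(𝒪_v)` in the spread level set of `W`, and `W(g' ι_v(x)) ≠ 0`,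
then `k` is invisible to `W` at EVERY base point: `n₀ = u⁻¹ u' = k k'⁻¹ ∈ N_v ∩ GL_{n+1}(𝒪_v)` acts on `W` by
`ψ_v(n₀)` (`IsSpreadWhittakerAt.right`, `|t_j| ≤ |t_i|` for `i ≤ j`), and `ψ_v(n₀) = 1` by the non-vanishing.
[folklore] -/
theorem sharp_of_two_decompositions (hW : IsSpreadWhittakerAt v ψ t M W) (hM₁ : 1 ≤ M)
    (hmono : ∀ i j : Fin (n + 1), i ≤ j → Valued.v (t j : v.adicCompletion K) ≤ Valued.v (t i : v.adicCompletion K))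
    {g' : GL (Fin (n + 1)) (AdeleRing (𝓞 K) K)} {x u k u' k' : GL (Fin (n + 1)) (v.adicCompletion K)}
    (hu : u ∈ upperUnitriangular (Fin (n + 1)) (v.adicCompletion K))
    (hk : k ∈ valuedCongruenceSubgroup (Fin (n + 1)) (exp (-M)))
    (hkW : ∀ y : GL (Fin (n + 1)) (v.adicCompletion K),
      W (g' * GLn.ofLocal (n + 1) K v (y * k)) = W (g' * GLn.ofLocal (n + 1) K v y))
    (hxuk : x = u * k)
    (hu' : u' ∈ upperUnitriangular (Fin (n + 1)) (v.adicCompletion K))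
    (hk'1 : k' ∈ valuedCongruenceSubgroup (Fin (n + 1)) (1 : ℤᵐ⁰))
    (hk'l : ∀ i j, Valued.v (((k' : Matrix (Fin (n + 1)) (Fin (n + 1)) (v.adicCompletion K)) - 1) i j * t j) ≤
      exp (-M) * Valued.v (t i : v.adicCompletion K))
    (hk'l' : ∀ i j, Valued.v ((((k'⁻¹ : GL (Fin (n + 1)) (v.adicCompletion K)) :
      Matrix (Fin (n + 1)) (Fin (n + 1)) (v.adicCompletion K)) - 1) i j * t j) ≤ exp (-M) * Valued.v (t i : v.adicCompletion K))
    (hxuk' : x = u' * k') (hne : W (g' * GLn.ofLocal (n + 1) K v x) ≠ 0) :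
    ∀ g : GL (Fin (n + 1)) (AdeleRing (𝓞 K) K), W (g * GLn.ofLocal (n + 1) K v k) = W g := by
  have hexpM : exp (-M) ≤ (1 : ℤᵐ⁰) := by rw [← exp_zero, exp_le_exp]; omega
  set n₀ : GL (Fin (n + 1)) (v.adicCompletion K) := u⁻¹ * u' with hn₀
  have hn₀N : n₀ ∈ upperUnitriangular (Fin (n + 1)) (v.adicCompletion K) := mul_mem (inv_mem hu) hu'
  have hukuk : u * k = u' * k' := hxuk.symm.trans hxuk'
  have hn₀eq : n₀ = k * k'⁻¹ := by
    rw [hn₀, eq_mul_inv_iff_mul_eq, mul_assoc, ← hukuk, inv_mul_cancel_left]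
  have hn₀K : n₀ ∈ valuedCongruenceSubgroup (Fin (n + 1)) (1 : ℤᵐ⁰) := by
    rw [hn₀eq]
    exact mul_mem (valuedCongruenceSubgroup_mono (Fin (n + 1)) hexpM hk) (inv_mem hk'1)
  have hbd : ∀ i j, Valued.v ((n₀ : Matrix (Fin (n + 1)) (Fin (n + 1)) (v.adicCompletion K)) i j * t j) ≤
      Valued.v (t i : v.adicCompletion K) := by
    intro i j
    by_cases hij : i ≤ j
    · rw [Valuation.map_mul]
      calc Valued.v ((n₀ : Matrix (Fin (n + 1)) (Fin (n + 1)) (v.adicCompletion K)) i j) * Valued.v (t j : v.adicCompletion K)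
          ≤ 1 * Valued.v (t i : v.adicCompletion K) := mul_le_mul' (hn₀K.1 i j) (hmono i j hij)
        _ = Valued.v (t i : v.adicCompletion K) := one_mul _
    · have h0 : (n₀ : Matrix (Fin (n + 1)) (Fin (n + 1)) (v.adicCompletion K)) i j = 0 :=
        ((mem_upperUnitriangular_iff _).1 hn₀N).1 (lt_of_not_ge hij)
      rw [h0, zero_mul, Valuation.map_zero]
      exact zero_le
  have hright : ∀ g : GL (Fin (n + 1)) (AdeleRing (𝓞 K) K),
      W (g * GLn.ofLocal (n + 1) K v n₀) = whittakerCharFun (ψ.adicComponent v) ⟨n₀, hn₀N⟩ * W g :=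
    hW.right n₀ hn₀N hbd
  have hkall : ∀ g : GL (Fin (n + 1)) (AdeleRing (𝓞 K) K),
      W (g * GLn.ofLocal (n + 1) K v k) = whittakerCharFun (ψ.adicComponent v) ⟨n₀, hn₀N⟩ * W g := by
    intro g
    have hk_eq : k = n₀ * k' := by rw [hn₀eq, inv_mul_cancel_right]
    rw [hk_eq, map_mul, ← mul_assoc, hW.level k' hk'l hk'l' _, hright]
  -- the phase is `1`: compare at the base point
  have hψ1 : whittakerCharFun (ψ.adicComponent v) ⟨n₀, hn₀N⟩ = 1 := by
    have h1 := hkW (x * k⁻¹)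
    rw [inv_mul_cancel_right] at h1
    have h2 := hkall (g' * GLn.ofLocal (n + 1) K v (x * k⁻¹))
    rw [mul_assoc, ← map_mul, inv_mul_cancel_right, ← h1] at h2
    exact (mul_eq_right₀ hne).1 h2.symm
  intro g
  rw [hkall, hψ1, one_mul]

/-- **Off `N_v K♯_v` the spread function vanishes on the thin set.** Let `W` be left `ψ`-equivariant and spread
at `v` (`IsSpreadWhittakerAt v ψ t M W` with the usual hypotheses on `ψ_v`, `M`, `t` and
`exp(-m)|t_0| ≤ exp(-M)|t_n|`), `g'` a base point with trivial `v`-component and `x ∈ GL_{n+1}(K_v)` with last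
row `≡ e_{n+1} (mod 𝔭_v^m)`. If `W(g' ι_v(x)) ≠ 0` then `x = u k` with `u ∈ N_{n+1}(K_v)` and `k ∈ K♯_v`
(the tree's `WhittakerSupport.exists_eq_unipotent_mul_level_of_lastRow` and
`WhittakerSupportValue.apply_eq_whittakerCharFun_mul_apply_one_of_lastRow_sub_le`, combined by
`sharp_of_two_decompositions`). [folklore] -/
theorem exists_sharp_of_ne_zero
    (hWN : ∀ (u : ↥(adelicUnipotent (n + 1) K)) (g : GL (Fin (n + 1)) (AdeleRing (𝓞 K) K)),
      W ((u : GL (Fin (n + 1)) (AdeleRing (𝓞 K) K)) * g) = whittakerCharFun ψ u * W g)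
    (hW : IsSpreadWhittakerAt v ψ t M W)
    (hψv : ∃ x : v.adicCompletion K, Valued.v x ≤ exp (1 - c₀) ∧ ψ.adicComponent v x ≠ 1) (hM₁ : 1 ≤ M)
    (hmono : ∀ i j : Fin (n + 1), i ≤ j → Valued.v (t j : v.adicCompletion K) ≤ Valued.v (t i : v.adicCompletion K))
    (hgap : ∀ i j : Fin (n + 1), (i : ℕ) + 1 = j →
      exp (M - c₀) * Valued.v (t j : v.adicCompletion K) ≤ Valued.v (t i : v.adicCompletion K))
    (hmt : exp (-(m : ℤ)) * Valued.v (t 0 : v.adicCompletion K) ≤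
      exp (-M) * Valued.v (t (Fin.last n) : v.adicCompletion K))
    {g' : GL (Fin (n + 1)) (AdeleRing (𝓞 K) K)} (hg' : localComponent v g' = 1)
    {x : GL (Fin (n + 1)) (v.adicCompletion K)}
    (hlast : ∀ j : Fin (n + 1), Valued.v ((x : Matrix (Fin (n + 1)) (Fin (n + 1)) (v.adicCompletion K)) (Fin.last n) j -
      if j = Fin.last n then 1 else 0) ≤ exp (-(m : ℤ)))
    (hne : W (g' * GLn.ofLocal (n + 1) K v x) ≠ 0) :
    ∃ u ∈ upperUnitriangular (Fin (n + 1)) (v.adicCompletion K), ∃ k : GL (Fin (n + 1)) (v.adicCompletion K),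
      (k ∈ valuedCongruenceSubgroup (Fin (n + 1)) (exp (-M)) ∧
        ∀ g : GL (Fin (n + 1)) (AdeleRing (𝓞 K) K), W (g * GLn.ofLocal (n + 1) K v k) = W g) ∧ x = u * k := by
  have hWloc : WhittakerSupport.IsSpreadWhittaker (ψ.adicComponent v) t M
      (fun h => W (g' * GLn.ofLocal (n + 1) K v h)) := isSpreadWhittaker_ofLocal hWN hW hg'
  have hlast' : ∀ j : Fin (n + 1), Valued.v ((x : Matrix (Fin (n + 1)) (Fin (n + 1)) (v.adicCompletion K)) (Fin.last n) j -
      if Fin.last n = j then 1 else 0) ≤ exp (-(m : ℤ)) := by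
    intro j
    have h := hlast j
    by_cases hj : j = Fin.last n
    · rw [if_pos hj.symm]; rwa [if_pos hj] at h
    · rw [if_neg (Ne.symm hj)]; rwa [if_neg hj] at h
  obtain ⟨u, hu, k, hk, hkW, hxuk⟩ := WhittakerSupport.exists_eq_unipotent_mul_level_of_lastRow (ψ.adicComponent v)
    hψv hM₁ hmono hgap hWloc (m₀ := (m : ℤ)) hmt hlast' hne
  obtain ⟨u', hu', k', hk'1, hk'l, hk'l', hxuk', -⟩ :=
    WhittakerSupportValue.apply_eq_whittakerCharFun_mul_apply_one_of_lastRow_sub_le (ψ.adicComponent v) hψv hM₁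
      hmono hgap hWloc hmt hlast hne
  exact ⟨u, hu, k, ⟨hk, sharp_of_two_decompositions hW hM₁ hmono hu hk hkW hxuk hu' hk'1 hk'l hk'l' hxuk' hne⟩, hxuk⟩

/-- **Phases cancel**: `ψ_N(u) · conj ψ_N(u) = 1`. [folklore] -/
theorem whittakerCharFun_mul_star {F : Type*} [CommRing F] {N : ℕ} (φ : AddChar F Circle)
    (u : ↥(upperUnitriangular (Fin N) F)) : whittakerCharFun φ u * star (whittakerCharFun φ u) = 1 := by
  rw [whittakerCharFun_apply, ← starRingEnd_apply, ← Circle.coe_inv_eq_conj, ← Circle.coe_mul, mul_inv_cancel,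
    Circle.coe_one]

/-- **The local value theorem for the pair at a thin place** (JPSS (1983), (2.7), in the tree's form). With `W`
left `ψ`-equivariant and spread at `v`, `W'` left `ψ`-equivariant and right `K_v(𝔭^M)`-invariant, `g'` a base point
with trivial `v`-component and `x ∈ GL_{n+1}(K_v)` with last row `≡ e_{n+1} (mod 𝔭_v^m)`:
`W(g' ι_v(x)) W̄'(g' ι_v(x)) = 𝟙[x ∈ N_v K♯_v] · W(g') W̄'(g')` — on `N_v K♯_v` both functions take the value
`ψ_v(u) ×` (value at `g'`) and the phases cancel; off it `W(g' ι_v(x)) = 0` (`exists_sharp_of_ne_zero`).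
[folklore] -/
theorem pair_apply_mul_ofLocal_eq
    (hWN : ∀ (u : ↥(adelicUnipotent (n + 1) K)) (g : GL (Fin (n + 1)) (AdeleRing (𝓞 K) K)),
      W ((u : GL (Fin (n + 1)) (AdeleRing (𝓞 K) K)) * g) = whittakerCharFun ψ u * W g)
    (hW'N : ∀ (u : ↥(adelicUnipotent (n + 1) K)) (g : GL (Fin (n + 1)) (AdeleRing (𝓞 K) K)),
      W' ((u : GL (Fin (n + 1)) (AdeleRing (𝓞 K) K)) * g) = whittakerCharFun ψ u * W' g)
    (hW : IsSpreadWhittakerAt v ψ t M W)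
    (hψv : ∃ x : v.adicCompletion K, Valued.v x ≤ exp (1 - c₀) ∧ ψ.adicComponent v x ≠ 1) (hM₁ : 1 ≤ M)
    (hmono : ∀ i j : Fin (n + 1), i ≤ j → Valued.v (t j : v.adicCompletion K) ≤ Valued.v (t i : v.adicCompletion K))
    (hgap : ∀ i j : Fin (n + 1), (i : ℕ) + 1 = j →
      exp (M - c₀) * Valued.v (t j : v.adicCompletion K) ≤ Valued.v (t i : v.adicCompletion K))
    (hmt : exp (-(m : ℤ)) * Valued.v (t 0 : v.adicCompletion K) ≤
      exp (-M) * Valued.v (t (Fin.last n) : v.adicCompletion K))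
    (hW'K : ∀ κ ∈ valuedCongruenceSubgroup (Fin (n + 1)) (exp (-M)), ∀ g : GL (Fin (n + 1)) (AdeleRing (𝓞 K) K),
      W' (g * GLn.ofLocal (n + 1) K v κ) = W' g)
    {g' : GL (Fin (n + 1)) (AdeleRing (𝓞 K) K)} (hg' : localComponent v g' = 1)
    {x : GL (Fin (n + 1)) (v.adicCompletion K)}
    (hlast : ∀ j : Fin (n + 1), Valued.v ((x : Matrix (Fin (n + 1)) (Fin (n + 1)) (v.adicCompletion K)) (Fin.last n) j -
      if j = Fin.last n then 1 else 0) ≤ exp (-(m : ℤ))) :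
    W (g' * GLn.ofLocal (n + 1) K v x) * star (W' (g' * GLn.ofLocal (n + 1) K v x)) =
      (if ∃ u ∈ upperUnitriangular (Fin (n + 1)) (v.adicCompletion K), ∃ k : GL (Fin (n + 1)) (v.adicCompletion K),
          (k ∈ valuedCongruenceSubgroup (Fin (n + 1)) (exp (-M)) ∧
            ∀ g : GL (Fin (n + 1)) (AdeleRing (𝓞 K) K), W (g * GLn.ofLocal (n + 1) K v k) = W g) ∧ x = u * k
        then (1 : ℂ) else 0) * (W g' * star (W' g')) := by
  split_ifs with hJ
  · obtain ⟨u, hu, k, ⟨hkK, hkW⟩, rfl⟩ := hJ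
    have hWv := apply_mul_ofLocal_unipotent_mul_sharp hWN hg' hu hkW
    have hW'v : W' (g' * GLn.ofLocal (n + 1) K v (u * k)) = whittakerCharFun (ψ.adicComponent v) ⟨u, hu⟩ * W' g' :=
      apply_mul_ofLocal_unipotent_mul_sharp hW'N hg' hu (hW'K k hkK)
    rw [hWv, hW'v, star_mul', one_mul]
    calc whittakerCharFun (ψ.adicComponent v) ⟨u, hu⟩ * W g' *
          (star (whittakerCharFun (ψ.adicComponent v) ⟨u, hu⟩) * star (W' g'))
        = (whittakerCharFun (ψ.adicComponent v) ⟨u, hu⟩ * star (whittakerCharFun (ψ.adicComponent v) ⟨u, hu⟩)) *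
            (W g' * star (W' g')) := by ring
      _ = W g' * star (W' g') := by rw [whittakerCharFun_mul_star, one_mul]
  · rw [zero_mul]
    by_cases hne : W (g' * GLn.ofLocal (n + 1) K v x) = 0
    · rw [hne, zero_mul]
    · exact absurd (exists_sharp_of_ne_zero hWN hW hψv hM₁ hmono hgap hmt hg' hlast hne) hJ

end Sharp

/-! ### The registered sub-goal: the local value theorem -/

section SubGoal

variable {n : ℕ} {K : Type} [Field K] [NumberField K]

/-- **SUB-GOAL (W4a, local value theorem at a thin place)**, `∀`-form of `pair_apply_mul_ofLocal_eq`: with `W`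
left `ψ`-equivariant and spread at `v`, `W'` left `ψ`-equivariant and right `K_v(𝔭^M)`-invariant, `g'` a base point
with trivial `v`-component and `x ∈ GL_{n+1}(K_v)` with last row `≡ e_{n+1} (mod 𝔭_v^m)`:
`W(g' ι_v(x)) W̄'(g' ι_v(x)) = 𝟙[x ∈ N_v K♯_v] · W(g') W̄'(g')`, `K♯_v = {k ∈ K_v(𝔭^M) : W(g ι_v(k)) = W(g) ∀ g}`
(Jacquet–Piatetski-Shapiro–Shalika (1983), (2.7)). [folklore] -/
theorem stub_unitBox_translate_localValue :
    ∀ {n : ℕ} {K : Type} [Field K] [NumberField K] {v : HeightOneSpectrum (𝓞 K)}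
      {ψ : AddChar (AdeleRing (𝓞 K) K) Circle} {W W' : GL (Fin (n + 1)) (AdeleRing (𝓞 K) K) → ℂ}
      {t : Fin (n + 1) → (v.adicCompletion K)ˣ} {M c₀ : ℤ} {m : ℕ}
      (_ : ∀ (u : ↥(adelicUnipotent (n + 1) K)) (g : GL (Fin (n + 1)) (AdeleRing (𝓞 K) K)), W ((u : GL (Fin (n + 1)) (AdeleRing (𝓞 K) K)) * g) = whittakerCharFun ψ u * W g)
      (_ : ∀ (u : ↥(adelicUnipotent (n + 1) K)) (g : GL (Fin (n + 1)) (AdeleRing (𝓞 K) K)), W' ((u : GL (Fin (n + 1)) (AdeleRing (𝓞 K) K)) * g) = whittakerCharFun ψ u * W' g)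
      (_ : IsSpreadWhittakerAt v ψ t M W)
      (_ : ∃ x : v.adicCompletion K, Valued.v x ≤ exp (1 - c₀) ∧ ψ.adicComponent v x ≠ 1) (_ : 1 ≤ M)
      (_ : ∀ i j : Fin (n + 1), i ≤ j → Valued.v (t j : v.adicCompletion K) ≤ Valued.v (t i : v.adicCompletion K))
      (_ : ∀ i j : Fin (n + 1), (i : ℕ) + 1 = j → exp (M - c₀) * Valued.v (t j : v.adicCompletion K) ≤ Valued.v (t i : v.adicCompletion K))
      (_ : exp (-(m : ℤ)) * Valued.v (t 0 : v.adicCompletion K) ≤ exp (-M) * Valued.v (t (Fin.last n) : v.adicCompletion K))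
      (_ : ∀ κ ∈ valuedCongruenceSubgroup (Fin (n + 1)) (exp (-M)), ∀ g : GL (Fin (n + 1)) (AdeleRing (𝓞 K) K), W' (g * GLn.ofLocal (n + 1) K v κ) = W' g)
      {g' : GL (Fin (n + 1)) (AdeleRing (𝓞 K) K)} (_ : localComponent v g' = 1)
      {x : GL (Fin (n + 1)) (v.adicCompletion K)}
      (_ : ∀ j : Fin (n + 1), Valued.v ((x : Matrix (Fin (n + 1)) (Fin (n + 1)) (v.adicCompletion K)) (Fin.last n) j - if j = Fin.last n then 1 else 0) ≤ exp (-(m : ℤ))),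
    W (g' * GLn.ofLocal (n + 1) K v x) * star (W' (g' * GLn.ofLocal (n + 1) K v x)) = (if ∃ u ∈ upperUnitriangular (Fin (n + 1)) (v.adicCompletion K), ∃ k : GL (Fin (n + 1)) (v.adicCompletion K), (k ∈ valuedCongruenceSubgroup (Fin (n + 1)) (exp (-M)) ∧ ∀ g : GL (Fin (n + 1)) (AdeleRing (𝓞 K) K), W (g * GLn.ofLocal (n + 1) K v k) = W g) ∧ x = u * k then (1 : ℂ) else 0) * (W g' * star (W' g')) := by
  intro n K _ _ v ψ W W' t M c₀ m hWN hW'N hW hψv hM₁ hmono hgap hmt hW'K g' hg' x hlast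
  exact pair_apply_mul_ofLocal_eq hWN hW'N hW hψv hM₁ hmono hgap hmt hW'K hg' hlast

end SubGoal

end Summit.Langlands.Langlands.Theorems.UnitBoxTranslateProductForm
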